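import Mathlib
import Summits.Ventures.HodgeRepro2.T5LocalSelfDuality
import Summits.Ventures.HodgeRepro2.T5AdicCompletionResidueField
import Summits.Ventures.HodgeRepro2.T5AdicCompletionConductor

/-!
# Self-duality of Mathlib's `adicCompletion K v`: every continuous character is `ψ(t·)` for a unique `t`
  — (A1′)'s «Pontryagin dual of `F_v = {ψ(t·)}`» on Mathlib's objects

The three hypotheses of `T5LocalSelfDuality` are discharged for `Kv := v.adicCompletion K`
(`K` a number field, `v` a finite place):

* `relIndex_ball_neg_one_zero_ne_zero`: `[B 0 : B (−1)] = |O_Kv / 𝔪| = N(v)` is finite — the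
  residue map `B 0 = O_Kv → k(O_Kv)` has kernel `B (−1) = 𝔪` (`T5AdicCompletionResidueField`);
* `relIndex_ball_ne_zero`: `[B a : B b] ≠ 0` for `b ≤ a` — scaling by powers of a uniformiser and
  `AddSubgroup.relIndex_mul_relIndex`;
* `exists_val_eq_exp`: every `exp j` is a value (`ϖ^{-j}` for a uniformiser `ϖ`,
  `T5AdicCompletionConductor`);
* `CompleteSpace Kv` — Mathlib.

Capstone `exists_unique_forall_eq_mulShift`: for a continuous non-trivial `ψ : AddChar Kv Circle`
and any continuous `χ`, `∃! t, ∀ x, χ x = ψ (t * x)`.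

Declaration per README §8(d): «uses an L-value-free non-vanishing device: NO».
-/

namespace Summit.Ventures.HodgeRepro2.T5AdicCompletionSelfDuality

open IsDedekindDomain HeightOneSpectrum WithZero IsLocalRing T5BallCharacters T5ValuedBallBasis

variable {R : Type*} [CommRing R] [IsDedekindDomain R] {K : Type*} [Field K] [Algebra R K]
  [IsFractionRing R K] (v : HeightOneSpectrum R)

section Values

/-- Every `exp j` is the valuation of some element (a power of a uniformiser). -/
theorem exists_val_eq_exp (j : ℤ) : ∃ u : adicCompletion K v, Valued.v u = exp j := by
  obtain ⟨ϖ, _, hϖ⟩ := T5AdicCompletionConductor.exists_irreducible_val_eq_exp_neg_one (K := K) v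
  refine ⟨(ϖ : adicCompletion K v) ^ (-j), ?_⟩
  rw [map_zpow₀, hϖ, ← exp_zsmul, smul_eq_mul]
  congr 1
  ring

end Values

section Index

/-- The inclusion of the unit ball `B 0` into `O_Kv`. -/
def ballToIntegers : ball (K := adicCompletion K v) 0 →+ adicCompletionIntegers K v where
  toFun x := ⟨(x : adicCompletion K v), by
    rw [mem_adicCompletionIntegers]
    simpa using mem_ball_iff.1 x.2⟩
  map_zero' := rfl
  map_add' _ _ := rfl

/-- The residue map on the unit ball `B 0 = O_Kv`. -/
noncomputable def ballResidue :
    ball (K := adicCompletion K v) 0 →+ ResidueField (adicCompletionIntegers K v) :=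
  (residue (adicCompletionIntegers K v)).toAddMonoidHom.comp (ballToIntegers v)

/-- The kernel of the residue map on `B 0` is `B (−1)`. -/
theorem ker_ballResidue :
    (ballResidue v).ker = (ball (K := adicCompletion K v) (-1)).addSubgroupOf (ball 0) := by
  ext x
  rw [AddMonoidHom.mem_ker, AddSubgroup.mem_addSubgroupOf, mem_ball_iff]
  change residue _ (ballToIntegers v x) = 0 ↔ _
  rw [residue_eq_zero_iff, T5AdicCompletionResidueField.mem_maximalIdeal_iff]
  change Valued.v (x : adicCompletion K v) < 1 ↔ _
  have h := lt_exp_succ_iff_le_exp (Valued.v (x : adicCompletion K v)) (-1)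
  rw [show (-1 : ℤ) + 1 = 0 by norm_num, exp_zero] at h
  exact h

/-- `[B 0 : B (−1)] ≠ 0` (it is `N(v)`). -/
theorem relIndex_ball_neg_one_zero_ne_zero [Finite (ResidueField (adicCompletionIntegers K v))] :
    (ball (K := adicCompletion K v) (-1)).relIndex (ball 0) ≠ 0 := by
  show ((ball (K := adicCompletion K v) (-1)).addSubgroupOf (ball 0)).index ≠ 0
  rw [← ker_ballResidue, AddSubgroup.index_ker]
  exact Nat.card_pos.ne'

/-- `[B (k+1) : B k] ≠ 0` for every `k`. -/
theorem relIndex_ball_succ_ne_zero [Finite (ResidueField (adicCompletionIntegers K v))] (k : ℤ) :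
    (ball (K := adicCompletion K v) k).relIndex (ball (k + 1)) ≠ 0 := by
  obtain ⟨u, hu⟩ := exists_val_eq_exp (K := K) v (k + 1)
  have := relIndex_ball_add hu 0 (-1)
  rw [show -1 + (k + 1) = k by ring, zero_add] at this
  rw [this]
  exact relIndex_ball_neg_one_zero_ne_zero v

/-- `[B a : B b] ≠ 0` for `b ≤ a`. -/
theorem relIndex_ball_ne_zero [Finite (ResidueField (adicCompletionIntegers K v))] (a b : ℤ)
    (hab : b ≤ a) : (ball (K := adicCompletion K v) b).relIndex (ball a) ≠ 0 := by
  obtain ⟨n, rfl⟩ : ∃ n : ℕ, a = b + n := ⟨(a - b).toNat, by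
    have := Int.toNat_of_nonneg (sub_nonneg.2 hab); omega⟩
  clear hab
  induction n with
  | zero => simp [AddSubgroup.relIndex_self]
  | succ n ih =>
    have h1 : ball (K := adicCompletion K v) b ≤ ball (b + n) := ball_mono (by omega)
    have h2 : ball (K := adicCompletion K v) (b + n) ≤ ball (b + (n + 1 : ℕ)) :=
      ball_mono (by push_cast; omega)
    rw [← AddSubgroup.relIndex_mul_relIndex _ _ _ h1 h2]
    apply mul_ne_zero ih
    have := relIndex_ball_succ_ne_zero (K := K) v (b + n)
    rwa [show b + (n + 1 : ℕ) = b + n + 1 by push_cast; ring]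

end Index

section Capstone

variable [Finite (ResidueField (adicCompletionIntegers K v))]

/-- SELF-DUALITY OF `Kv`: every continuous character is a shift of a continuous non-trivial one. -/
theorem exists_forall_eq_mulShift (ψ : AddChar (adicCompletion K v) Circle) (hψc : Continuous ψ)
    (hψ : ψ ≠ 1) (χ : AddChar (adicCompletion K v) Circle) (hχc : Continuous χ) :
    ∃ t : adicCompletion K v, ∀ x, χ x = ψ (t * x) :=
  T5LocalSelfDuality.exists_forall_eq_mulShift (fun a b hab => relIndex_ball_ne_zero v a b hab)
    (exists_val_eq_exp v) ψ hψc hψ χ hχc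

/-- … for a UNIQUE `t`. -/
theorem exists_unique_forall_eq_mulShift (ψ : AddChar (adicCompletion K v) Circle)
    (hψc : Continuous ψ) (hψ : ψ ≠ 1) (χ : AddChar (adicCompletion K v) Circle)
    (hχc : Continuous χ) : ∃! t : adicCompletion K v, ∀ x, χ x = ψ (t * x) := by
  obtain ⟨t, ht⟩ := exists_forall_eq_mulShift v ψ hψc hψ χ hχc
  refine ⟨t, ht, fun t' ht' => ?_⟩
  exact T5LocalSelfDuality.eq_of_forall_mulShift_eq ψ hψc hψ fun x => by rw [← ht' x, ← ht x]

end Capstone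

section NumberField

variable {K : Type*} [Field K] [NumberField K] (v : HeightOneSpectrum (NumberField.RingOfIntegers K))

/-- For a number field the residue field is finite (`T5AdicCompletionResidueField`), so: -/
theorem exists_unique_forall_eq_mulShift_numberField (ψ : AddChar (adicCompletion K v) Circle)
    (hψc : Continuous ψ) (hψ : ψ ≠ 1) (χ : AddChar (adicCompletion K v) Circle)
    (hχc : Continuous χ) : ∃! t : adicCompletion K v, ∀ x, χ x = ψ (t * x) :=
  exists_unique_forall_eq_mulShift v ψ hψc hψ χ hχc

end NumberField

end Summit.Ventures.HodgeRepro2.T5AdicCompletionSelfDuality
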